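import Mathlib
import Summits.Ventures.HodgeRepro2.T5AdicCompletionSelfDuality
import Summits.Ventures.HodgeRepro2.T5CharactersTrivialOnBase
import Summits.Ventures.HodgeRepro2.T5AdicCompletionSummary
import Summits.Ventures.HodgeRepro2.T5QuadraticBasis

/-!
# (A1′) ON MATHLIB'S COMPLETIONS: the characters of `Lw` trivial on `Kv` are exactly the `ψ₀(t·)`, `t ∈ Kv`

`Kv ⊆ Lw` Mathlib's completions of number fields (`w ∣ v`, the canonical algebra of
`T5AdicCompletionMap`), `b = (1, δ)` a `Kv`-basis of `Lw`, `ψ_F : AddChar Kv Circle` continuous and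
non-trivial, `ψ₀ := ofBase b ψ_F` (the character `y ↦ ψ_F(δ-coordinate of y)` of `Lw`, trivial on
`Kv` — `T5CharactersTrivialOnBase`).  Then for every continuous `χ : AddChar Lw Circle` trivial on
`Kv` there is a UNIQUE `t ∈ Kv` with `χ = ψ₀(t·)`:

the linear-algebra half (`T5CharactersTrivialOnBase.ofBase_toBase`) writes `χ = ofBase b φ` with
`φ = toBase b χ : c ↦ χ(c δ)` continuous; the self-duality of `Kv`
(`T5AdicCompletionSelfDuality`) writes `φ = ψ_F(t·)`; and `coordHom` is `Kv`-linear.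

This is N5.12.6 (A1′) as printed — «the characters of `E_v` trivial on `F_v` are `x ↦ ψ₀(tx)`,
`t ∈ F_v` (`E_v/F_v ≅ F_v` as a one-dimensional `F_v`-space; Pontryagin dual of `F_v = {ψ(t·)}`);
non-trivial ones: `t ≠ 0`» — on Mathlib's objects, both halves kernel-checked.  The last section
removes the basis from the hypotheses: from `[Lw : Kv] = 2` and a non-trivial automorphism `σ` alone
(`T5QuadraticBasis`) there is an anti-invariant `δ` with `(1, δ)` a basis, and (A1′) holds for the
character `ψ₀ := ofBase (1, δ) ψ_F`.

Declaration per README §8(d): «uses an L-value-free non-vanishing device: NO».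
-/

namespace Summit.Ventures.HodgeRepro2.T5AdicCompletionRelativeDuality

open IsDedekindDomain HeightOneSpectrum T5CharactersTrivialOnBase

variable {K : Type*} [Field K] [NumberField K] (v : HeightOneSpectrum (NumberField.RingOfIntegers K))
  {L : Type*} [Field L] [NumberField L] [Algebra K L]
  (w : HeightOneSpectrum (NumberField.RingOfIntegers L)) [w.asIdeal.LiesOver v.asIdeal]
  (b : Module.Basis (Fin 2) (adicCompletion K v) (adicCompletion L w))

/-- The `δ`-coordinate is `Kv`-linear. -/
theorem coordHom_smul' (t : adicCompletion K v) (y : adicCompletion L w) :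
    coordHom b (t • y) = t * coordHom b y := by
  rw [coordHom_apply, coordHom_apply, map_smul, Finsupp.smul_apply, smul_eq_mul]

/-- `toBase b χ : c ↦ χ (c • δ)` is continuous when `χ` is. -/
theorem continuous_toBase (χ : AddChar (adicCompletion L w) Circle) (hχc : Continuous χ) :
    Continuous (toBase b χ) := by
  have : (toBase b χ : adicCompletion K v → Circle) = fun c => χ (c • b 1) := by
    funext c
    exact toBase_apply b χ c
  rw [this]
  exact hχc.comp (continuous_id.smul continuous_const)

/-- `ψ₀(t • y) = ψ_F(t · coord y)`. -/
theorem ofBase_smul' (ψF : AddChar (adicCompletion K v) Circle) (t : adicCompletion K v)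
    (y : adicCompletion L w) :
    ofBase b ψF (t • y) = ψF (t * coordHom b y) := by
  rw [ofBase_apply, coordHom_smul']

/-- (A1′), EXISTENCE: a continuous character of `Lw` trivial on `Kv` is `ψ₀(t·)` for some `t ∈ Kv`. -/
theorem exists_forall_eq_ofBase_smul (hb : b 0 = 1) (ψF : AddChar (adicCompletion K v) Circle)
    (hψc : Continuous ψF) (hψ : ψF ≠ 1) (χ : AddChar (adicCompletion L w) Circle)
    (hχc : Continuous χ) (hχ : ∀ a : adicCompletion K v, χ (algebraMap _ _ a) = 1) :
    ∃ t : adicCompletion K v, ∀ y : adicCompletion L w, χ y = ofBase b ψF (t • y) := by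
  obtain ⟨t, ht⟩ := T5AdicCompletionSelfDuality.exists_forall_eq_mulShift v ψF hψc hψ (toBase b χ)
    (continuous_toBase v w b χ hχc)
  refine ⟨t, fun y => ?_⟩
  rw [ofBase_smul', ← ht, ← ofBase_apply, ofBase_toBase b hb χ hχ]

/-- (A1′), UNIQUENESS: `ψ₀(t·) = ψ₀(t'·)` forces `t = t'`. -/
theorem eq_of_forall_ofBase_smul_eq (ψF : AddChar (adicCompletion K v) Circle)
    (hψc : Continuous ψF) (hψ : ψF ≠ 1) {t t' : adicCompletion K v}
    (h : ∀ y : adicCompletion L w, ofBase b ψF (t • y) = ofBase b ψF (t' • y)) : t = t' := by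
  apply T5LocalSelfDuality.eq_of_forall_mulShift_eq ψF hψc hψ
  intro c
  have := h (c • b 1)
  rw [ofBase_smul', ofBase_smul', coordHom_smul] at this
  exact this

/-- (A1′) on Mathlib's completions: ∃! `t ∈ Kv`, `χ = ψ₀(t·)`. -/
theorem existsUnique_forall_eq_ofBase_smul (hb : b 0 = 1) (ψF : AddChar (adicCompletion K v) Circle)
    (hψc : Continuous ψF) (hψ : ψF ≠ 1) (χ : AddChar (adicCompletion L w) Circle)
    (hχc : Continuous χ) (hχ : ∀ a : adicCompletion K v, χ (algebraMap _ _ a) = 1) :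
    ∃! t : adicCompletion K v, ∀ y : adicCompletion L w, χ y = ofBase b ψF (t • y) := by
  obtain ⟨t, ht⟩ := exists_forall_eq_ofBase_smul v w b hb ψF hψc hψ χ hχc hχ
  exact ⟨t, ht, fun t' ht' =>
    eq_of_forall_ofBase_smul_eq v w b ψF hψc hψ fun y => by rw [← ht' y, ← ht y]⟩

/-- The same with `t • y` written as `algebraMap t * y` (the printed `ψ₀(tx)`). -/
theorem existsUnique_forall_eq_ofBase_mul (hb : b 0 = 1) (ψF : AddChar (adicCompletion K v) Circle)
    (hψc : Continuous ψF) (hψ : ψF ≠ 1) (χ : AddChar (adicCompletion L w) Circle)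
    (hχc : Continuous χ) (hχ : ∀ a : adicCompletion K v, χ (algebraMap _ _ a) = 1) :
    ∃! t : adicCompletion K v, ∀ y : adicCompletion L w,
      χ y = ofBase b ψF (algebraMap (adicCompletion K v) (adicCompletion L w) t * y) := by
  simp only [← Algebra.smul_def]
  exact existsUnique_forall_eq_ofBase_smul v w b hb ψF hψc hψ χ hχc hχ

/-- «non-trivial ones: `t ≠ 0`»: `ψ₀(t·)` is trivial iff `t = 0`. -/
theorem ofBase_smul_eq_one_iff (ψF : AddChar (adicCompletion K v) Circle)
    (hψc : Continuous ψF) (hψ : ψF ≠ 1) (t : adicCompletion K v) :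
    (∀ y : adicCompletion L w, ofBase b ψF (t • y) = 1) ↔ t = 0 := by
  constructor
  · intro h
    apply eq_of_forall_ofBase_smul_eq v w b ψF hψc hψ
    intro y
    rw [h y, zero_smul, AddChar.map_zero_eq_one]
  · rintro rfl y
    rw [zero_smul, AddChar.map_zero_eq_one]

section FromAutomorphism

omit b

/-- (A1′) from the conjugation alone: `[Lw : Kv] = 2`, `σ ≠ 1` ⇒ ∃ an anti-invariant basis `(1, δ)`
such that for every continuous non-trivial `ψ_F` and every continuous `χ` trivial on `Kv`,
`χ = ψ₀(t·)` for a unique `t ∈ Kv`, `ψ₀ := ofBase (1, δ) ψ_F`. -/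
theorem exists_basis_forall_existsUnique
    (h2 : Module.finrank (adicCompletion K v) (adicCompletion L w) = 2)
    (σ : adicCompletion L w ≃ₐ[adicCompletion K v] adicCompletion L w) (hσ : σ ≠ 1) :
    ∃ b : Module.Basis (Fin 2) (adicCompletion K v) (adicCompletion L w), b 0 = 1 ∧ σ (b 1) = -b 1 ∧
      ∀ (ψF : AddChar (adicCompletion K v) Circle), Continuous ψF → ψF ≠ 1 →
        ∀ (χ : AddChar (adicCompletion L w) Circle), Continuous χ →
          (∀ a : adicCompletion K v, χ (algebraMap _ _ a) = 1) →
            ∃! t : adicCompletion K v, ∀ y : adicCompletion L w, χ y = ofBase b ψF (t • y) := by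
  obtain ⟨b, hb0, hb1⟩ := T5QuadraticBasis.exists_basis h2 σ hσ
  exact ⟨b, hb0, hb1, fun ψF hψc hψ χ hχc hχ =>
    existsUnique_forall_eq_ofBase_smul v w b hb0 ψF hψc hψ χ hχc hχ⟩

end FromAutomorphism

end Summit.Ventures.HodgeRepro2.T5AdicCompletionRelativeDuality
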